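/-
Copyright (c) 2026 the pub-hodgecm-mathlib formalisation cell (harness21).  Prover seat hodgecm-mathlib-LH4-p06 (g3): Track A «(D-RAM) FOUR-FRAME» squad of crux H413, unit
U3_Laws, (KMS) road «MODULO κ-STAGE B», brick κB-H «CORE-HANGING κ-SOCKETS» FILE (A2) (dealer LH4-plan (g11) WORD #34), 2026-09-04.
-/
import Summits.HodgeConjecture.HodgeConjecture.Theorems.F0P3cDyRamDiagonalCoreHangingPolarisationExplicit -- FILE (A1) (this seat): the explicit type-0 polarisation of a core-hanging lattice (★ B7 (i) re-run, form exposed) and its ω-table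
import Summits.HodgeConjecture.HodgeConjecture.Theorems.F0P3cDyRamDiagonalCoreHangingCount       -- ★ p856098 (LH4-p07 (g3)) (C): `isNormalisedLattice_latt_coreHanging`; brings ★ (A) orbits
import Summits.HodgeConjecture.HodgeConjecture.Theorems.F0P3cDyRamDiagonalKappaCountEval        -- ★ (LH4-p05 (g3)) Fκ2: `kappaCount_zero_eq_of_dichotomy`, `chiVec`, `normSign_mul_of_dichotomy`
import Summits.HodgeConjecture.HodgeConjecture.Theorems.F0P3cDyRamDiagonalGluedFixedStabiliser   -- ★ (LH4-p08 (g2)): `mem_fixedUnitStabilizer_latt_glued_iff` (the `S_F`-membership of a glued∕core-hanging lattice)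
import Summits.HodgeConjecture.HodgeConjecture.Theorems.F0P3cDyRamDiagonalKappaSplitCountEval     -- ★ (LH4-p04 (g2)) κB-T (1): `normSign_mul_self` (reused — dedup gate)
import Literature.NumberTheory.LocalFields.WildQuadraticDatumNormSignConductor                   -- ★ p856540 (this seat): the ω-conductor toolkit (deep fixed units are norms; the break-level non-norm; `ω` multiplicative)
import HarnessLib

/-!
# Crux `H413`, (KMS) ROAD «MODULO κ-STAGE B», brick κB-H FILE (A2): THE κ-COUNT OF A CORE-HANGING LATTICE — `kappaCount σ ϖ 0 i M = [2d−1 ≤ ρ]·χ_i(f)` on the unit-torus orbit of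
# `latt V_H(1,1,f)`, with `(χ_0, χ_1, χ_2)(f) = (ω(−(1+f)), ω(f)ω(−(1+f)), ω(f))` (LH4-p06 (g3) head letter da173de2deea6757 (F1)–(F3); LH4-r01 (g3) oracle ER: 340∕340 at q = 4)

Cell `hodgecm-mathlib` (D-0151), FLOOR 0, crux item H413 = `stmt-HodgeConjecture-24833`; lane `--supports stmt-HodgeConjecture-24833 --as helper` (count-neutral).  THEOREMS ONLY
(no `def`, no instance, no notation, no `sorry`, default heartbeats).  Inputs: FILE (A1) `F0P3cDyRamDiagonalCoreHangingPolarisationExplicit` (★ p07 (g3) B7 (i) re-run with the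
polarising form exposed, and its ω-table), ★ (A)∕(C) (orbit members are `latt V_H(x′, ζ′, y₁)` with the EXACT invariant `y₁∕(x′ζ′) = f`; normalised), ★ p08 (g2)
`mem_fixedUnitStabilizer_latt_glued_iff` at `s = 0` (the shape of `S_F`), ★ p05 (g3) Fκ2 `kappaCount_zero_eq_of_dichotomy` (the type-0 closed form `κ = [χ_i ≡ 1 on S_F]·χ_i(D₁)`),
★ this seat's ω-conductor toolkit p856540 (`ω ≡ 1` on `U_F(2d−1)`, a non-norm in `U_F(2d−2)`, `ω` multiplicative).

THE MATHEMATICS (letter da173de2 (F2)(F3)).  For `M = latt (1 0 0; x ϖ^ρ 0; xζ(1+f) ϖ^ρζ ϖ^{2ρ})` (`x, ζ` units of `K`, `f` a FIXED unit with `|1 + f| = 1` — every member of the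
`𝒯`-orbit of `latt V_H(1,1,f)` has this shape, ★ (A) `exists_coreHanging_of_mem_orbit`):
* FILE (A1): the explicit type-0 polarisation `D` of ★ B7 (i) and its ω-table at `y″ = f·xζ`, `f′ = f·Nζ`: `(ω(D₀), ω(D₁), ω(D₂)) = (ω(f), 1, ω(−(1+f)))`, hence
  `χ_0(D) = ω(−(1+f))`, `χ_1(D) = ω(f)ω(−(1+f))`, `χ_2(D) = ω(f)`.
* §3 THE ALIVE WINDOW: `S_F(M) = {u : |u₂−u₁| ≤ |ϖ|^ρ, |(u₂−u₁)∕f + (u₂−u₀)| ≤ |ϖ|^{2ρ}}`; if `2d−1 ≤ ρ` every pair `u_l∕u_m ∈ U_F(ρ) ⊆ N(Kˣ)` so `χ_i ≡ 1 on S_F` (toolkit §3); if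
  `ρ ≤ 2d−2` the break-level non-norm `c` (toolkit §2) gives `u ∈ S_F` with `χ_i(u) = −1` for each `i` (witnesses `(1+(1−c)∕f, c, 1)`, `(c, 1+f(1−c), 1)`,
  `(1 − t∕f, 1 + t, 1)` with `t = (1−c)∕(1∕f + c)` — the last uses `|1 + f| = 1`).
* §4 HEAD `kappaCount_zero_latt_coreHanging_eq`: `kappaCount σ ϖ 0 i M = if 2d−1 ≤ ρ then (ω(−(1+f)), ω(f)ω(−(1+f)), ω(f))_i else 0` — FILE (B) sums it over the stratum.
HONEST LABEL.  Count-neutral; `HC_CM` is proved only modulo the 7 printed citations (2 remaining named inputs: hLiu418 = `stmt-HodgeConjecture-24832`, h413 = `stmt-HodgeConjecture-24833`)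
until rung 0 closes.

## References
* [Kottwitz1986BaseChangeUnits] R. Kottwitz, *Base change for unit elements of Hecke algebras*, Compositio Math. 60 (1986), §1 pp. 240–241 (κ-orbital integrals as signed lattice counts).
* [Rogawski1990] J. D. Rogawski, *Automorphic Representations of Unitary Groups in Three Variables*, Ann. of Math. Stud. 123 (1990), §4.9 Prop. 4.9.1 (a) p. 55; §4.10 p. 58.
* [Jacobowitz1962] R. Jacobowitz, *Hermitian forms over local fields*, Amer. J. Math. 84 (1962), §7 (unimodular lattices, dual bases).
* [Serre1979] J.-P. Serre, *Local Fields*, GTM 67 (1979), Ch. V §3 Cor. 3, Ch. XV §2 (the conductor of the quadratic character).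
-/

set_option autoImplicit false

noncomputable section

namespace Summit.HodgeConjecture.HodgeConjecture.Cruxes.H413.F0P3cDyRamDiagonalKappaCoreHangingClass

open Matrix WithZero
open Literature.NumberTheory.Automorphic Literature.NumberTheory.Automorphic.HermitianLattice Literature.NumberTheory.Automorphic.UnitaryGroup
open Literature.NumberTheory.Automorphic.UnitaryLatticeTree Literature.NumberTheory.Automorphic.UnitaryThreeFourFrame
open Literature.NumberTheory.LocalFields.WildQuadraticDatum
open Summit.HodgeConjecture.HodgeConjecture.Cruxes.H413.F0P3cDyRamDiagonalTorusDefs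
open Summit.HodgeConjecture.HodgeConjecture.Cruxes.H413.F0P3cDyRamDiagonalGluedTubeCriterion
open Summit.HodgeConjecture.HodgeConjecture.Cruxes.H413.F0P3cDyRamDiagonalCoreHangingCriterion
open Summit.HodgeConjecture.HodgeConjecture.Cruxes.H413.F0P3cDyRamDiagonalCoreHangingCount
open Summit.HodgeConjecture.HodgeConjecture.Cruxes.H413.F0P3cDyRamDiagonalGluedFixedStabiliser
open Summit.HodgeConjecture.HodgeConjecture.Cruxes.H413.F0P3cDyRamDiagonalKappaCountDefs
open Summit.HodgeConjecture.HodgeConjecture.Cruxes.H413.F0P3cDyRamDiagonalKappaCountEval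
open Summit.HodgeConjecture.HodgeConjecture.Cruxes.H413.F0P3cDyRamDiagonalCoreHangingPolarisationExplicit
open Summit.HodgeConjecture.HodgeConjecture.Cruxes.H413.F0P3cDyRamDiagonalKappaSplitCountEval (normSign_mul_self)
open scoped Valued WithZero Matrix MatrixGroups

variable {K : Type} [Field K] [Valued K ℤᵐ⁰]

/-- At a wild place (`|2| < 1`) the different exponent of the datum is `≥ 2` (an odd `d` equals `t + 1`, ★ `eq_succ_of_odd`). [cite: Serre1979, Ch. V §3 Cor. 3] -/
theorem two_le_d_of_v_two_lt_one {σ : K →+* K} {ϖ : K} {d t : ℕ} (hD : IsRamifiedQuadraticDatum σ ϖ d t) (h2 : Valued.v (2 : K) < 1) : 2 ≤ d := by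
  obtain ⟨hσ, -, hϖ, hfix, hd, hd1, ht⟩ := hD
  by_contra hlt
  have hd1' : d = 1 := by omega
  subst hd1'
  have hodd : Odd 1 := ⟨0, by norm_num⟩
  have h01 := eq_succ_of_odd hσ hfix hϖ hd ht hodd
  rw [ht, show t = 0 by omega, pow_zero] at h2
  exact lt_irrefl _ h2

/-! ## §3 The alive window of `S_F` for a core-hanging lattice with exact invariant `f` -/

omit [Valued K ℤᵐ⁰] in
/-- Unfolding `chiVec` at the three slots. [cite: Rogawski1990, §4.10 p. 58] -/
theorem chiVec_apply (σ : K →+* K) (D : Fin 3 → K) (i : Fin 3) :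
    chiVec σ i D = (![normSign σ (D 1) * normSign σ (D 2), normSign σ (D 0) * normSign σ (D 2), normSign σ (D 0) * normSign σ (D 1)] : Fin 3 → ℤ) i := rfl

/-- **ALIVE**: if `2d−1 ≤ ρ` then `χ_i ≡ 1` on `S_F` of the core-hanging lattice (all three pair ratios of a stabilising fixed unit lie in `U_F(ρ) ⊆ N(Kˣ)`, toolkit §3).
[cite: Serre1979, Ch. XV §2] [cite: Kottwitz1986BaseChangeUnits, §1 pp. 240–241] -/
theorem chiVec_eq_one_of_mem_fixedUnitStabilizer_of_le [CompleteSpace K] {σ : K →+* K} {ϖ : K} {d t : ℕ} (hD : IsRamifiedQuadraticDatum σ ϖ d t)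
    (ρ : ℕ) {x ζ f : K} (hx : Valued.v x = 1) (hζ : Valued.v ζ = 1) (hf : Valued.v f = 1)
    (V : GL (Fin 3) K) (hV : (V : Matrix (Fin 3) (Fin 3) K) = !![1, 0, 0; x, ϖ ^ ρ, 0; x * ζ + f * (x * ζ), ϖ ^ ρ * ζ, ϖ ^ (2 * ρ + 0)])
    (hρ : 2 * d - 1 ≤ ρ) {u : Fin 3 → Kˣ} (hu : u ∈ fixedUnitStabilizer σ (latt (V : Matrix (Fin 3) (Fin 3) K))) (i : Fin 3) :
    chiVec σ i (fun j => ((u j : Kˣ) : K)) = 1 := by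
  obtain ⟨hσ, hvσ, hϖ, hfix, hd, hd1, ht⟩ := id hD
  have hϖ0 : ϖ ≠ 0 := fun h => by rw [h, map_zero] at hϖ; exact (exp_ne_zero hϖ.symm).elim
  have hϖ1 : Valued.v ϖ ≤ 1 := by rw [hϖ, ← exp_zero, exp_le_exp]; norm_num
  have hf0 : f ≠ 0 := fun h => by rw [h, map_zero] at hf; exact zero_ne_one hf
  have huT : u ∈ fixedUnitTorus σ 3 := hu.2
  have hufix : ∀ j, σ ((u j : Kˣ) : K) = u j := fun j => ((mem_fixedUnitTorus_iff σ u).1 huT).2 j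
  have huv : ∀ j, Valued.v ((u j : Kˣ) : K) = 1 := fun j => ((mem_fixedUnitTorus_iff σ u).1 huT).1 j
  -- the membership letters at `s = 0` with lineariser `g = 1∕f`
  have hmem := (mem_fixedUnitStabilizer_latt_glued_iff (σ := σ) hϖ0 hϖ1 ρ 0 (x := x) (ζ := ζ) (y'' := f * (x * ζ)) (g := f⁻¹) hx hζ
    (by rw [pow_zero, map_mul, map_mul, hf, hx, hζ, one_mul, one_mul]) (by rw [pow_zero, mul_one, map_inv₀, hf, inv_one])
    (by rw [show x * ζ - f⁻¹ * (f * (x * ζ)) = 0 by rw [← mul_assoc, inv_mul_cancel₀ hf0, one_mul, sub_self], map_zero]; exact zero_le) V hV huT).1 hu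
  obtain ⟨h21, h20⟩ := hmem
  rw [Nat.add_zero] at h21
  -- all pairs are `ρ`-close
  have hpow2 : Valued.v ϖ ^ (2 * ρ) ≤ Valued.v ϖ ^ ρ := pow_le_pow_right_of_le_one' hϖ1 (by omega)
  have h20' : Valued.v (((u 2 : Kˣ) : K) - u 0) ≤ Valued.v ϖ ^ ρ := by
    have e : ((u 2 : Kˣ) : K) - u 0 = (f⁻¹ * (((u 2 : Kˣ) : K) - u 1) + (((u 2 : Kˣ) : K) - u 0)) + -(f⁻¹ * (((u 2 : Kˣ) : K) - u 1)) := by ring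
    rw [e]
    refine (Valuation.map_add _ _ _).trans (max_le (h20.trans hpow2) ?_)
    rw [Valuation.map_neg, map_mul, map_inv₀, hf, inv_one, one_mul]; exact h21
  have h10 : Valued.v (((u 1 : Kˣ) : K) - u 0) ≤ Valued.v ϖ ^ ρ := by
    have e : ((u 1 : Kˣ) : K) - u 0 = (((u 2 : Kˣ) : K) - u 0) + -(((u 2 : Kˣ) : K) - u 1) := by ring
    rw [e]
    exact (Valuation.map_add _ _ _).trans (max_le h20' (by rw [Valuation.map_neg]; exact h21))
  -- hence all three `ω` agree
  have hω21 : normSign σ ((u 1 : Kˣ) : K) = normSign σ ((u 2 : Kˣ) : K) := normSign_eq_of_near hD (hufix 2) (hufix 1) (huv 2) hρ h21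
  have hω20 : normSign σ ((u 0 : Kˣ) : K) = normSign σ ((u 2 : Kˣ) : K) := normSign_eq_of_near hD (hufix 2) (hufix 0) (huv 2) hρ h20'
  rw [chiVec_apply]
  fin_cases i
  · simp only [Fin.zero_eta, cons_val_zero]; rw [hω21]; exact normSign_mul_self σ _
  · simp only [Fin.mk_one, cons_val_one, cons_val_zero]; rw [hω20]; exact normSign_mul_self σ _
  · simp only [Fin.reduceFinMk, cons_val_two, Nat.succ_eq_add_one, Nat.reduceAdd, tail_cons, head_cons]
    rw [hω20, hω21]; exact normSign_mul_self σ _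

/-- **DEAD**: if `ρ ≤ 2d−2` (and `|2| < 1`) then for each slot `i` some `u ∈ S_F` has `χ_i(u) ≠ 1` (witnesses built from the break-level non-norm `c`, toolkit §2; the slot `i = 2`
uses `|1 + f| = 1`). [cite: Serre1979, Ch. V §3 Cor. 3] [cite: Kottwitz1986BaseChangeUnits, §1 pp. 240–241] -/
theorem exists_mem_fixedUnitStabilizer_chiVec_ne_one_of_lt [CompleteSpace K] [Finite 𝓀[K]] {σ : K →+* K} {ϖ : K} {d t : ℕ}
    (hD : IsRamifiedQuadraticDatum σ ϖ d t) (h2 : Valued.v (2 : K) < 1)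
    (ρ : ℕ) {x ζ f : K} (hx : Valued.v x = 1) (hζ : Valued.v ζ = 1) (hσf : σ f = f) (hf : Valued.v f = 1) (h1f : Valued.v (1 + f) = 1)
    (V : GL (Fin 3) K) (hV : (V : Matrix (Fin 3) (Fin 3) K) = !![1, 0, 0; x, ϖ ^ ρ, 0; x * ζ + f * (x * ζ), ϖ ^ ρ * ζ, ϖ ^ (2 * ρ + 0)])
    (hρ : ρ ≤ 2 * d - 2) (i : Fin 3) :
    ∃ u ∈ fixedUnitStabilizer σ (latt (V : Matrix (Fin 3) (Fin 3) K)), chiVec σ i (fun j => ((u j : Kˣ) : K)) ≠ 1 := by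
  obtain ⟨hσ, hvσ, hϖ, hfix, hd, hd1, ht⟩ := id hD
  have hϖ0 : ϖ ≠ 0 := fun h => by rw [h, map_zero] at hϖ; exact (exp_ne_zero hϖ.symm).elim
  have hϖ1 : Valued.v ϖ ≤ 1 := by rw [hϖ, ← exp_zero, exp_le_exp]; norm_num
  have hf0 : f ≠ 0 := fun h => by rw [h, map_zero] at hf; exact zero_ne_one hf
  have hd2 : 2 ≤ d := two_le_d_of_v_two_lt_one hD h2
  -- the break-level non-norm `c`, `|c − 1| ≤ |ϖ|^ρ`, `|c − 1| < 1`
  obtain ⟨c, hσc, hc1, hcd, hcn⟩ := exists_fixed_unit_not_norm_v_sub_one_le hD h2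
  have hc0 : c ≠ 0 := fun h => by rw [h, map_zero] at hc1; exact zero_ne_one hc1
  have hcρ : Valued.v (c - 1) ≤ Valued.v ϖ ^ ρ := by
    refine hcd.trans ?_
    rw [v_varpi_pow hϖ, exp_le_exp]; omega
  have hc1ρ : Valued.v (1 - c) ≤ Valued.v ϖ ^ ρ := by rw [← neg_sub, Valuation.map_neg]; exact hcρ
  have hclt : Valued.v (1 - c) < 1 := by
    rw [← neg_sub, Valuation.map_neg]
    refine hcd.trans_lt ?_
    rw [← exp_zero, exp_lt_exp]; omega
  have hωc : normSign σ c = -1 := normSign_of_not_isNorm σ hcn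
  have hω1 : normSign σ (1 : K) = 1 := normSign_one σ
  -- membership letters (`s = 0`, lineariser `1∕f`)
  have key : ∀ {u : Fin 3 → Kˣ}, u ∈ fixedUnitTorus σ 3 →
      Valued.v (((u 2 : Kˣ) : K) - u 1) ≤ Valued.v ϖ ^ ρ → Valued.v (f⁻¹ * (((u 2 : Kˣ) : K) - u 1) + (((u 2 : Kˣ) : K) - u 0)) ≤ Valued.v ϖ ^ (2 * ρ) →
        u ∈ fixedUnitStabilizer σ (latt (V : Matrix (Fin 3) (Fin 3) K)) := fun {u} huT h21 h20 =>
    (mem_fixedUnitStabilizer_latt_glued_iff (σ := σ) hϖ0 hϖ1 ρ 0 (x := x) (ζ := ζ) (y'' := f * (x * ζ)) (g := f⁻¹) hx hζ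
      (by rw [pow_zero, map_mul, map_mul, hf, hx, hζ, one_mul, one_mul]) (by rw [pow_zero, mul_one, map_inv₀, hf, inv_one])
      (by rw [show x * ζ - f⁻¹ * (f * (x * ζ)) = 0 by rw [← mul_assoc, inv_mul_cancel₀ hf0, one_mul, sub_self], map_zero]; exact zero_le) V hV huT).2 ⟨by rw [Nat.add_zero]; exact h21, h20⟩
  -- a unit builder
  have mkU : ∀ a : K, Valued.v a = 1 → ∃ au : Kˣ, (au : K) = a := fun a ha =>
    ⟨Units.mk0 a (fun h => by rw [h, map_zero] at ha; exact zero_ne_one ha), rfl⟩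
  fin_cases i
  · -- i = 0: u = (1 + (1 − c)∕f, c, 1), χ_0(u) = ω(c)ω(1) = −1
    set a : K := 1 + f⁻¹ * (1 - c) with ha
    have hσa : σ a = a := by rw [ha, map_add, map_one, map_mul, map_inv₀, hσf, map_sub, map_one, hσc]
    have hsm : Valued.v (f⁻¹ * (1 - c)) < 1 := by rw [map_mul, map_inv₀, hf, inv_one, one_mul]; exact hclt
    have hva : Valued.v a = 1 := by rw [ha, Valuation.map_add_eq_of_lt_left _ (by rwa [map_one]), map_one]
    obtain ⟨au, hau⟩ := mkU a hva
    obtain ⟨cu, hcu⟩ := mkU c hc1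
    refine ⟨![au, cu, 1], key ?_ ?_ ?_, ?_⟩
    · rw [mem_fixedUnitTorus_iff]
      refine ⟨fun j => ?_, fun j => ?_⟩ <;> fin_cases j
      · show Valued.v (au : K) = 1; rw [hau]; exact hva
      · show Valued.v (cu : K) = 1; rw [hcu]; exact hc1
      · show Valued.v ((1 : Kˣ) : K) = 1; rw [Units.val_one, map_one]
      · show σ (au : K) = au; rw [hau]; exact hσa
      · show σ (cu : K) = cu; rw [hcu]; exact hσc
      · show σ ((1 : Kˣ) : K) = (1 : Kˣ); rw [Units.val_one, map_one]
    · show Valued.v (((1 : Kˣ) : K) - cu) ≤ _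
      rw [Units.val_one, hcu]; exact hc1ρ
    · show Valued.v (f⁻¹ * (((1 : Kˣ) : K) - cu) + (((1 : Kˣ) : K) - au)) ≤ _
      rw [Units.val_one, hcu, hau, ha, show f⁻¹ * (1 - c) + (1 - (1 + f⁻¹ * (1 - c))) = 0 by ring, map_zero]; exact zero_le
    · rw [chiVec_apply]
      show normSign σ (cu : K) * normSign σ ((1 : Kˣ) : K) ≠ 1
      rw [hcu, Units.val_one, hωc, hω1]; norm_num
  · -- i = 1: u = (c, 1 + f(1 − c), 1), χ_1(u) = ω(c)ω(1) = −1
    set a : K := 1 + f * (1 - c) with ha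
    have hσa : σ a = a := by rw [ha, map_add, map_one, map_mul, hσf, map_sub, map_one, hσc]
    have hsm : Valued.v (f * (1 - c)) ≤ Valued.v ϖ ^ ρ := by rw [map_mul, hf, one_mul]; exact hc1ρ
    have hva : Valued.v a = 1 := by
      have hlt : Valued.v (f * (1 - c)) < 1 := by rw [map_mul, hf, one_mul]; exact hclt
      rw [ha, Valuation.map_add_eq_of_lt_left _ (by rwa [map_one]), map_one]
    obtain ⟨au, hau⟩ := mkU a hva
    obtain ⟨cu, hcu⟩ := mkU c hc1
    refine ⟨![cu, au, 1], key ?_ ?_ ?_, ?_⟩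
    · rw [mem_fixedUnitTorus_iff]
      refine ⟨fun j => ?_, fun j => ?_⟩ <;> fin_cases j
      · show Valued.v (cu : K) = 1; rw [hcu]; exact hc1
      · show Valued.v (au : K) = 1; rw [hau]; exact hva
      · show Valued.v ((1 : Kˣ) : K) = 1; rw [Units.val_one, map_one]
      · show σ (cu : K) = cu; rw [hcu]; exact hσc
      · show σ (au : K) = au; rw [hau]; exact hσa
      · show σ ((1 : Kˣ) : K) = (1 : Kˣ); rw [Units.val_one, map_one]
    · show Valued.v (((1 : Kˣ) : K) - au) ≤ _
      rw [Units.val_one, hau, ha, show (1 : K) - (1 + f * (1 - c)) = -(f * (1 - c)) by ring, Valuation.map_neg]; exact hsm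
    · show Valued.v (f⁻¹ * (((1 : Kˣ) : K) - au) + (((1 : Kˣ) : K) - cu)) ≤ _
      rw [Units.val_one, hcu, hau, ha, show f⁻¹ * (1 - (1 + f * (1 - c))) + (1 - c) = 0 by field_simp; ring, map_zero]; exact zero_le
    · rw [chiVec_apply]
      show normSign σ (cu : K) * normSign σ ((1 : Kˣ) : K) ≠ 1
      rw [hcu, Units.val_one, hωc, hω1]; norm_num
  · -- i = 2: u = (1 − t∕f, 1 + t, 1), t = (1 − c)∕(1∕f + c): u₀∕u₁ = c, so χ_2(u) = ω(u₀)ω(u₁) = ω(c·u₁)ω(u₁) = −1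
    have hgc : Valued.v (f⁻¹ + c) = 1 := by
      have e : f⁻¹ + c = f⁻¹ * (1 + f) + (c - 1) := by field_simp; ring
      have h1 : Valued.v (f⁻¹ * (1 + f)) = 1 := by rw [map_mul, map_inv₀, hf, inv_one, one_mul, h1f]
      have hlt : Valued.v (c - 1) < 1 := by rw [← neg_sub, Valuation.map_neg]; exact hclt
      rw [e, Valuation.map_add_eq_of_lt_left _ (by rwa [h1]), h1]
    have hgc0 : f⁻¹ + c ≠ 0 := fun h => by rw [h, map_zero] at hgc; exact zero_ne_one hgc
    set τ : K := (1 - c) / (f⁻¹ + c) with hτ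
    have hστ : σ τ = τ := by rw [hτ, map_div₀, map_sub, map_one, hσc, map_add, map_inv₀, hσf, hσc]
    have hvτ : Valued.v τ ≤ Valued.v ϖ ^ ρ := by rw [hτ, map_div₀, hgc, div_one]; exact hc1ρ
    have hvτ1 : Valued.v τ < 1 := by rw [hτ, map_div₀, hgc, div_one]; exact hclt
    set a₁ : K := 1 + τ with ha₁
    set a₀ : K := 1 - f⁻¹ * τ with ha₀
    have hσa₁ : σ a₁ = a₁ := by rw [ha₁, map_add, map_one, hστ]
    have hσa₀ : σ a₀ = a₀ := by rw [ha₀, map_sub, map_one, map_mul, map_inv₀, hσf, hστ]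
    have hva₁ : Valued.v a₁ = 1 := by rw [ha₁, Valuation.map_add_eq_of_lt_left _ (by rwa [map_one]), map_one]
    have hva₀ : Valued.v a₀ = 1 := by
      have hlt : Valued.v (-(f⁻¹ * τ)) < 1 := by rw [Valuation.map_neg, map_mul, map_inv₀, hf, inv_one, one_mul]; exact hvτ1
      rw [ha₀, sub_eq_add_neg, Valuation.map_add_eq_of_lt_left _ (by rwa [map_one]), map_one]
    have hratio : a₀ = c * a₁ := by
      have hτm : τ * (f⁻¹ + c) = 1 - c := by rw [hτ, div_mul_cancel₀ _ hgc0]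
      rw [ha₀, ha₁]; linear_combination -hτm
    obtain ⟨au₀, hau₀⟩ := mkU a₀ hva₀
    obtain ⟨au₁, hau₁⟩ := mkU a₁ hva₁
    have ha₁0 : a₁ ≠ 0 := fun h => by rw [h, map_zero] at hva₁; exact zero_ne_one hva₁
    refine ⟨![au₀, au₁, 1], key ?_ ?_ ?_, ?_⟩
    · rw [mem_fixedUnitTorus_iff]
      refine ⟨fun j => ?_, fun j => ?_⟩ <;> fin_cases j
      · show Valued.v (au₀ : K) = 1; rw [hau₀]; exact hva₀
      · show Valued.v (au₁ : K) = 1; rw [hau₁]; exact hva₁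
      · show Valued.v ((1 : Kˣ) : K) = 1; rw [Units.val_one, map_one]
      · show σ (au₀ : K) = au₀; rw [hau₀]; exact hσa₀
      · show σ (au₁ : K) = au₁; rw [hau₁]; exact hσa₁
      · show σ ((1 : Kˣ) : K) = (1 : Kˣ); rw [Units.val_one, map_one]
    · show Valued.v (((1 : Kˣ) : K) - au₁) ≤ _
      rw [Units.val_one, hau₁, ha₁, show (1 : K) - (1 + τ) = -τ by ring, Valuation.map_neg]; exact hvτ
    · show Valued.v (f⁻¹ * (((1 : Kˣ) : K) - au₁) + (((1 : Kˣ) : K) - au₀)) ≤ _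
      rw [Units.val_one, hau₁, hau₀, ha₁, ha₀, show f⁻¹ * (1 - (1 + τ)) + (1 - (1 - f⁻¹ * τ)) = 0 by ring, map_zero]; exact zero_le
    · rw [chiVec_apply]
      show normSign σ (au₀ : K) * normSign σ (au₁ : K) ≠ 1
      rw [hau₀, hau₁, hratio, normSign_mul_eq_neg_of_not_norm hD hσc hcn hσa₁ ha₁0, neg_mul, normSign_mul_self σ a₁]
      norm_num

/-! ## §4 HEAD (FILE A): the κ-count of a core-hanging lattice with exact invariant `f` -/

/-- **THE κ-COUNT OF A CORE-HANGING LATTICE** (letter da173de2 (F3); LH4-r01 (g3) oracle 340∕340): for the datum (`|2| < 1`, complete `K`, finite residue field, the wild trace bound),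
`ρ ≥ 1`, units `x, ζ`, a FIXED unit `f` with `|1 + f| = 1`, and `M = latt (1 0 0; x ϖ^ρ 0; xζ + f·xζ ϖ^ρζ ϖ^{2ρ})` (every member of the unit-torus orbit of `latt V_H(1,1,f)`, ★ (A)):
`kappaCount σ ϖ 0 i M = if 2d − 1 ≤ ρ then (ω(−(1+f)), ω(f)·ω(−(1+f)), ω(f))_i else 0`. [cite: Kottwitz1986BaseChangeUnits, §1 pp. 240–241] [cite: Rogawski1990, §4.9 Prop. 4.9.1 (a) p. 55; §4.10 p. 58] -/
theorem kappaCount_zero_latt_coreHanging_eq [CompleteSpace K] [Finite 𝓀[K]] {σ : K →+* K} {ϖ : K} {d t : ℕ}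
    (hD : IsRamifiedQuadraticDatum σ ϖ d t) (h2 : Valued.v (2 : K) < 1) (hTr : ∀ a : K, Valued.v (a + σ a) ≤ Valued.v ϖ * Valued.v a)
    {ρ : ℕ} (hρ : 1 ≤ ρ) {x ζ f : K} (hx : Valued.v x = 1) (hζ : Valued.v ζ = 1) (hσf : σ f = f) (hf : Valued.v f = 1) (h1f : Valued.v (1 + f) = 1)
    (V : GL (Fin 3) K) (hV : (V : Matrix (Fin 3) (Fin 3) K) = !![1, 0, 0; x, ϖ ^ ρ, 0; x * ζ + f * (x * ζ), ϖ ^ ρ * ζ, ϖ ^ (2 * ρ)]) (i : Fin 3) :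
    kappaCount σ ϖ 0 i (latt (V : Matrix (Fin 3) (Fin 3) K)) =
      if 2 * d - 1 ≤ ρ then (![normSign σ (-(1 + f)), normSign σ f * normSign σ (-(1 + f)), normSign σ f] : Fin 3 → ℤ) i else 0 := by
  obtain ⟨hσ, hvσ, hϖ, hfix, hd, hd1, ht⟩ := id hD
  have hϖ0 : ϖ ≠ 0 := fun h => by rw [h, map_zero] at hϖ; exact (exp_ne_zero hϖ.symm).elim
  have hϖ1 : Valued.v ϖ < 1 := by rw [hϖ, ← exp_zero, exp_lt_exp]; norm_num
  have hζ0 : ζ ≠ 0 := fun h => by rw [h, map_zero] at hζ; exact zero_ne_one hζ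
  have hN0 : ζ * σ ζ ≠ 0 := mul_ne_zero hζ0 ((map_ne_zero σ).2 hζ0)
  -- the unit letters of the stratum
  have hy''1 : Valued.v (f * (x * ζ)) = 1 := by rw [map_mul, map_mul, hf, hx, hζ, one_mul, one_mul]
  have hy1 : Valued.v (x * ζ + f * (x * ζ)) = 1 := by
    rw [show x * ζ + f * (x * ζ) = x * ζ * (1 + f) by ring, map_mul, map_mul, hx, hζ, h1f, one_mul, one_mul]
  -- §1 with the lineariser `f′ = f·ζσζ` (criterion (R) holds on the nose)
  have hσf' : σ (f * (ζ * σ ζ)) = f * (ζ * σ ζ) := by rw [map_mul, map_mul, hσf, hσ, mul_comm (σ ζ) ζ]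
  have hR : Valued.v (ζ * σ (f * (x * ζ)) - σ x * (f * (ζ * σ ζ))) ≤ Valued.v ϖ ^ ρ := by
    rw [show ζ * σ (f * (x * ζ)) - σ x * (f * (ζ * σ ζ)) = 0 by rw [map_mul, map_mul, hσf]; ring, map_zero]; exact zero_le
  obtain ⟨D, ⟨hD1, hD2, hD0⟩, hDσ, hDV⟩ := exists_explicit_polarisation_latt_hnf_coreHanging hσ hvσ hϖ0 hϖ1 hTr ρ hρ hx hζ hy''1 hy1 V hV hσf' hR
  -- the type-0 closed form (★ Fκ2) with the NI2 letters of the toolkit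
  obtain ⟨c₀, hσc₀, hc₀n, hdich⟩ := exists_nonnorm_dichotomy hD
  have hnorm : IsNormalisedLattice (latt (V : Matrix (Fin 3) (Fin 3) K)) := by
    rw [hV]; exact isNormalisedLattice_latt_coreHanging hϖ1.le ρ hx hζ hy1
  rw [kappaCount_zero_eq_of_dichotomy hvσ hσc₀ hc₀n hdich ϖ i V rfl hnorm hDσ hDV]
  -- the ω-table of `D`
  obtain ⟨hω1, hω2, hω0⟩ := normSign_polarisation_coreHanging σ hϖ0 ρ hx hζ hσf hf h1f hD1 hD2 hD0
  have hχ : chiVec σ i D = (![normSign σ (-(1 + f)), normSign σ f * normSign σ (-(1 + f)), normSign σ f] : Fin 3 → ℤ) i := by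
    rw [chiVec_apply]
    fin_cases i
    · simp only [Fin.zero_eta, cons_val_zero]; rw [hω1, hω2, one_mul]
    · simp only [Fin.mk_one, cons_val_one, cons_val_zero]; rw [hω0, hω2]
    · simp only [Fin.reduceFinMk, cons_val_two, Nat.succ_eq_add_one, Nat.reduceAdd, tail_cons, head_cons]; rw [hω0, hω1, mul_one]
  have hV0 : (V : Matrix (Fin 3) (Fin 3) K) = !![1, 0, 0; x, ϖ ^ ρ, 0; x * ζ + f * (x * ζ), ϖ ^ ρ * ζ, ϖ ^ (2 * ρ + 0)] := by rw [Nat.add_zero]; exact hV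
  by_cases hal : 2 * d - 1 ≤ ρ
  · rw [if_pos hal, if_pos (fun u hu => chiVec_eq_one_of_mem_fixedUnitStabilizer_of_le hD ρ hx hζ hf V hV0 hal hu i), hχ]
  · rw [if_neg hal, if_neg]
    obtain ⟨u, hu, hne⟩ := exists_mem_fixedUnitStabilizer_chiVec_ne_one_of_lt hD h2 ρ hx hζ hσf hf h1f V hV0 (by omega) i
    exact fun h => hne (h u hu)

end Summit.HodgeConjecture.HodgeConjecture.Cruxes.H413.F0P3cDyRamDiagonalKappaCoreHangingClass

end
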